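import Summits.ResolutionOfSingularities.ResolutionOfSingularities.Theorems.FloorCutClasses
import Summits.ResolutionOfSingularities.ResolutionOfSingularities.Theorems.MaxContactCutFloorCut
import Summits.ResolutionOfSingularities.ResolutionOfSingularities.Theorems.MarkedTransferCampaignW46MohWindowShadeAnchorOrder
import Literature.AlgebraicGeometry.Resolution.PointBlowupFlagTranslatedStep
import HarnessLib

/-!
# FloorDescent (1/6) — §1–§3: exponent bookkeeping, `q`-power polynomials, the ARC CONDITION `ArcCond`, `OrdGE`
(pure commutative algebra)

Part of the node «FloorDescent» (decomp-res · lens-5 g34): the ORDER FLOOR cell `FloorCut.NoFloorTailsDeep` of the deep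
tight-defect column DECIDED IN KERNEL for every prime `p` and exponent `e` (statement, mechanism and honest placement in
the module docstring of `FloorDescent6`; record HOME/decomp-res-lens-5/g34/NODE-g34.md).  Verbatim slice of the farm-checked
monolith `HOME/decomp-res-lens-5/g34/FloorDescent.lean` (lines 61–343); one namespace across the six slices.

WRITER NOTE (decomp-res writer g13, dedup): the lens's helper `not_isPthPowerExponent_of_clean` restated the landed
`CampaignW46.MohWindowShadeAnchorOrder.not_isPthPowerExponent_of_cleaned` (tree file
`MarkedTransferCampaignW46MohWindowShadeAnchorOrder`, gate `dedup.landed`), so the copy is dropped, that module imported here and its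
two use sites (`eq_zero_of_isQPow_of_clean` below, `transversality_law` in `FloorDescent4`) cite the landed name; nothing else changed.
-/

open MvPolynomial Finset
open scoped BigOperators Polynomial
open Literature.AlgebraicGeometry.Resolution
open Literature.AlgebraicGeometry.Resolution.Hauser2010
open Literature.AlgebraicGeometry.Resolution.PointBlowup
open Literature.AlgebraicGeometry.Resolution.HauserPerlega2024
open Summit.ResolutionOfSingularities.ResolutionOfSingularities.Theorems.TightDefectClasses

namespace Summit.ResolutionOfSingularities.ResolutionOfSingularities.Theorems.FloorDescent


noncomputable section


/-! ## §1 Exponent bookkeeping: the off-degree, `q`-power polynomials, the arc condition -/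

section Exponents

variable {σ : Type} [DecidableEq σ] [Fintype σ]

/-- The OFF-`j` DEGREE `|d|_{≠ j} = Σ_{i ≠ j} d_i` of an exponent. [folklore] -/
def offDeg (j : σ) (d : σ →₀ ℕ) : ℕ := ∑ i ∈ univ.erase j, d i

/-- `sum_eq_erase_add`: Auxiliary step of this node's calculus, VERBATIM from the lens file (see the module
docstring); the statement is its type. [folklore] -/
theorem sum_eq_erase_add (f : σ → ℕ) (j : σ) : ∑ i, f i = (∑ i ∈ univ.erase j, f i) + f j := by
  rw [Finset.sum_erase_add _ _ (mem_univ j)]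

/-- `degree_eq_offDeg_add`: Auxiliary step of this node's calculus, VERBATIM from the lens file (see the module
docstring); the statement is its type. [folklore] -/
theorem degree_eq_offDeg_add (j : σ) (d : σ →₀ ℕ) : d.degree = offDeg j d + d j := by
  rw [Finsupp.degree_eq_sum, offDeg]
  exact sum_eq_erase_add d j

/-- `offDeg_add`: Auxiliary step of this node's calculus, VERBATIM from the lens file (see the module docstring);
the statement is its type. [folklore] -/
theorem offDeg_add (j : σ) (d e : σ →₀ ℕ) : offDeg j (d + e) = offDeg j d + offDeg j e := by
  simp only [offDeg, Finsupp.add_apply, Finset.sum_add_distrib]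

/-- `offDeg_single_self`: Auxiliary step of this node's calculus, VERBATIM from the lens file (see the module
docstring); the statement is its type. [folklore] -/
theorem offDeg_single_self (j : σ) (n : ℕ) : offDeg j (Finsupp.single j n) = 0 := by
  unfold offDeg
  exact Finset.sum_eq_zero fun i hi => by rw [Finsupp.single_apply, if_neg (ne_of_mem_erase hi).symm]

/-- `offDeg_single_ne`: Auxiliary step of this node's calculus, VERBATIM from the lens file (see the module
docstring); the statement is its type. [folklore] -/
theorem offDeg_single_ne (j : σ) {i : σ} (hij : i ≠ j) (n : ℕ) : offDeg j (Finsupp.single i n) = n := by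
  unfold offDeg
  rw [Finset.sum_eq_single i]
  · exact Finsupp.single_eq_same
  · intro l _ hl; rw [Finsupp.single_apply, if_neg (Ne.symm hl)]
  · intro h; exact absurd (mem_erase.mpr ⟨hij, mem_univ i⟩) h

/-- `offDeg_eq_zero_iff`: Auxiliary step of this node's calculus, VERBATIM from the lens file (see the module
docstring); the statement is its type. [folklore] -/
theorem offDeg_eq_zero_iff (j : σ) (d : σ →₀ ℕ) : offDeg j d = 0 ↔ ∀ i, i ≠ j → d i = 0 := by
  unfold offDeg
  rw [Finset.sum_eq_zero_iff]
  exact ⟨fun h i hi => h i (mem_erase.mpr ⟨hi, mem_univ i⟩), fun h i hi => h i (ne_of_mem_erase hi)⟩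

/-- `le_offDeg`: Auxiliary step of this node's calculus, VERBATIM from the lens file (see the module docstring); the
statement is its type. [folklore] -/
theorem le_offDeg (j : σ) (d : σ →₀ ℕ) {i : σ} (hij : i ≠ j) : d i ≤ offDeg j d := by
  unfold offDeg
  exact Finset.single_le_sum (f := fun i => d i) (fun _ _ => Nat.zero_le _) (mem_erase.mpr ⟨hij, mem_univ i⟩)

/-- `dvd_offDeg`: Auxiliary step of this node's calculus, VERBATIM from the lens file (see the module docstring);
the statement is its type. [folklore] -/
theorem dvd_offDeg (j : σ) {q : ℕ} {d : σ →₀ ℕ} (h : ∀ i, q ∣ d i) : q ∣ offDeg j d :=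
  Finset.dvd_sum fun i _ => h i

/-- The degree of the chart exponent: `|d'| = |d|_{≠ j} + (|d| − q)`. [folklore] -/
theorem degree_chartExponent (q : ℕ) (j : σ) (d : σ →₀ ℕ) :
    (chartExponent q j d).degree = offDeg j d + (d.degree - q) := by
  rw [Finsupp.degree_eq_sum, sum_eq_erase_add _ j, offDeg]
  congr 1
  · exact Finset.sum_congr rfl fun i hi => by rw [chartExponent_apply, if_neg (ne_of_mem_erase hi)]
  · rw [chartExponent_apply, if_pos rfl]

omit [Fintype σ] in
/-- `chartExponent_apply_self`: Auxiliary step of this node's calculus, VERBATIM from the lens file (see the module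
docstring); the statement is its type. [folklore] -/
theorem chartExponent_apply_self (q : ℕ) (j : σ) (d : σ →₀ ℕ) : chartExponent q j d j = d.degree - q := by
  rw [chartExponent_apply, if_pos rfl]

omit [Fintype σ] in
/-- `chartExponent_apply_ne`: Auxiliary step of this node's calculus, VERBATIM from the lens file (see the module
docstring); the statement is its type. [folklore] -/
theorem chartExponent_apply_ne (q : ℕ) (j : σ) (d : σ →₀ ℕ) {i : σ} (hij : i ≠ j) :
    chartExponent q j d i = d i := by
  rw [chartExponent_apply, if_neg hij]

/-- `offDeg_chartExponent`: Auxiliary step of this node's calculus, VERBATIM from the lens file (see the module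
docstring); the statement is its type. [folklore] -/
theorem offDeg_chartExponent (q : ℕ) (j : σ) (d : σ →₀ ℕ) : offDeg j (chartExponent q j d) = offDeg j d :=
  Finset.sum_congr rfl fun _ hi => chartExponent_apply_ne q j d (ne_of_mem_erase hi)

end Exponents

section QPow

variable {σ : Type} [DecidableEq σ] [Fintype σ] {K : Type} [Field K]

/-- `q`-POWER POLYNOMIALS: every monomial has all exponents divisible by `q` (`K[y^q]`, the span of the
`q`-th power monomials; the part of `F` invisible to Hasse derivatives of order `< q` and deleted by
cleaning). -/
def IsQPow (q : ℕ) (G : MvPolynomial σ K) : Prop := ∀ d ∈ G.support, IsPthPowerExponent q d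

omit [DecidableEq σ] [Fintype σ] in
/-- `isQPow_iff_coeff`: Auxiliary step of this node's calculus, VERBATIM from the lens file (see the module
docstring); the statement is its type. [folklore] -/
theorem isQPow_iff_coeff (q : ℕ) (G : MvPolynomial σ K) :
    IsQPow q G ↔ ∀ d, coeff d G ≠ 0 → ∀ i, q ∣ d i := by
  simp only [IsQPow, MvPolynomial.mem_support_iff, isPthPowerExponent_iff]

omit [DecidableEq σ] [Fintype σ] in
/-- `IsQPow.zero`: Auxiliary step of this node's calculus, VERBATIM from the lens file (see the module docstring);
the statement is its type. [folklore] -/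
theorem IsQPow.zero (q : ℕ) : IsQPow q (0 : MvPolynomial σ K) := fun d hd => by simp at hd

omit [Fintype σ] in
/-- `IsQPow.add`: Auxiliary step of this node's calculus, VERBATIM from the lens file (see the module docstring);
the statement is its type. [folklore] -/
theorem IsQPow.add {q : ℕ} {G H : MvPolynomial σ K} (hG : IsQPow q G) (hH : IsQPow q H) : IsQPow q (G + H) :=
  fun d hd => by
    rcases Finset.mem_union.mp (support_add hd) with h | h
    · exact hG d h
    · exact hH d h

omit [DecidableEq σ] [Fintype σ] in
/-- `IsQPow.neg`: Auxiliary step of this node's calculus, VERBATIM from the lens file (see the module docstring);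
the statement is its type. [folklore] -/
theorem IsQPow.neg {q : ℕ} {G : MvPolynomial σ K} (hG : IsQPow q G) : IsQPow q (-G) :=
  fun d hd => hG d (by rwa [support_neg] at hd)

omit [Fintype σ] in
/-- `IsQPow.sub`: Auxiliary step of this node's calculus, VERBATIM from the lens file (see the module docstring);
the statement is its type. [folklore] -/
theorem IsQPow.sub {q : ℕ} {G H : MvPolynomial σ K} (hG : IsQPow q G) (hH : IsQPow q H) : IsQPow q (G - H) := by
  rw [sub_eq_add_neg]; exact hG.add hH.neg

omit [Fintype σ] in
/-- `IsQPow.sum`: Auxiliary step of this node's calculus, VERBATIM from the lens file (see the module docstring);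
the statement is its type. [folklore] -/
theorem IsQPow.sum {q : ℕ} {ι : Type} (s : Finset ι) (f : ι → MvPolynomial σ K) (h : ∀ i ∈ s, IsQPow q (f i)) :
    IsQPow q (∑ i ∈ s, f i) := by
  classical
  induction s using Finset.induction_on with
  | empty => rw [Finset.sum_empty]; exact IsQPow.zero q
  | insert a s ha ih =>
    rw [Finset.sum_insert ha]
    exact (h a (mem_insert_self a s)).add (ih fun i hi => h i (mem_insert_of_mem hi))

omit [DecidableEq σ] [Fintype σ] in
/-- `IsQPow.C_mul`: Auxiliary step of this node's calculus, VERBATIM from the lens file (see the module docstring);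
the statement is its type. [folklore] -/
theorem IsQPow.C_mul {q : ℕ} {G : MvPolynomial σ K} (hG : IsQPow q G) (c : K) : IsQPow q (C c * G) := by
  rw [isQPow_iff_coeff] at hG ⊢
  intro d hd
  rw [coeff_C_mul] at hd
  exact hG d (right_ne_zero_of_mul hd)

omit [DecidableEq σ] [Fintype σ] in
/-- `isQPow_monomial`: Auxiliary step of this node's calculus, VERBATIM from the lens file (see the module
docstring); the statement is its type. [folklore] -/
theorem isQPow_monomial {q : ℕ} {d : σ →₀ ℕ} (hd : ∀ i, q ∣ d i) (c : K) :
    IsQPow q (monomial d c : MvPolynomial σ K) := fun e he => by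
  classical
  have : e = d := by
    have := support_monomial_subset he
    simpa using this
  subst this
  exact fun i _ => hd i

omit [Fintype σ] in
/-- In characteristic `p`, a `q = pᵉ`-th power is a `q`-power polynomial: `(Σ c_d y^d)^q = Σ c_d^q y^{qd}`
(Frobenius). [folklore] -/
theorem IsQPow.pow {p : ℕ} [Fact p.Prime] [CharP K p] (e : ℕ) (H : MvPolynomial σ K) :
    IsQPow (p ^ e) (H ^ p ^ e) := by
  classical
  rw [H.as_sum, sum_pow_char_pow]
  refine IsQPow.sum _ _ fun d _ => ?_
  rw [monomial_pow]
  exact isQPow_monomial (fun i => by simp) _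

omit [DecidableEq σ] [Fintype σ] in
/-- A `q`-power exponent is `q • (d / q)`. [folklore] -/
theorem eq_smul_div_of_dvd {q : ℕ} (_hq : 0 < q) {d : σ →₀ ℕ} (hd : ∀ i, q ∣ d i) :
    d = q • Finsupp.mapRange (fun n => n / q) (Nat.zero_div q) d := by
  ext i
  rw [Finsupp.smul_apply, Finsupp.mapRange_apply, smul_eq_mul, Nat.mul_div_cancel' (hd i)]

omit [Fintype σ] in
/-- `q`-power polynomials are preserved by EVERY `K`-algebra endomorphism of `K[y]` (characteristic `p`,
`q = pᵉ`): `f(Σ c (y^a)^q) = Σ c (f y^a)^q`. [folklore] -/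
theorem IsQPow.map_algHom {p : ℕ} [Fact p.Prime] [CharP K p] {e : ℕ} {G : MvPolynomial σ K}
    (hG : IsQPow (p ^ e) G) (f : MvPolynomial σ K →ₐ[K] MvPolynomial σ K) : IsQPow (p ^ e) (f G) := by
  classical
  have hq : 0 < p ^ e := pow_pos (Fact.out : p.Prime).pos e
  rw [G.as_sum, map_sum]
  refine IsQPow.sum _ _ fun d hd => ?_
  have hd' : ∀ i, p ^ e ∣ d i := (isPthPowerExponent_iff _ _).mp (hG d hd)
  set a := Finsupp.mapRange (fun n => n / p ^ e) (Nat.zero_div (p ^ e)) d with ha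
  have hmon : (MvPolynomial.monomial d (coeff d G) : MvPolynomial σ K) =
      C (coeff d G) * (MvPolynomial.monomial a 1) ^ p ^ e := by
    rw [monomial_pow, one_pow, ← eq_smul_div_of_dvd hq hd', C_mul_monomial, mul_one]
  have hC : f (C (coeff d G)) = C (coeff d G) := by
    rw [← MvPolynomial.algebraMap_eq]; exact f.commutes _
  rw [hmon, map_mul, map_pow, hC]
  exact (IsQPow.pow e _).C_mul _

end QPow

/-! ## §2 The arc condition `ArcCond j q m` (monomial form of `G ∈ (y_j^m, y_i : i ≠ j)^q + K[y^q]`) -/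

section Arc

variable {σ : Type} [DecidableEq σ] [Fintype σ] {K : Type} [Field K]

/-- **The ARC CONDITION of depth `m` in the `j`-based frame**: every monomial `y^d` of `G` is either a
`q`-th power monomial or satisfies `m·(q − |d|_{≠j}) ≤ d_j` — i.e. `G` lies in the monomial ideal
`(y_j^m, y_i : i ≠ j)^q` up to `q`-power monomials: "`δ(G; y_j; y_{≠ j}) ≥ m`", Hironaka's invariant of the
characteristic polyhedron in the curve-like (`e ≤ 1`) situation, truncated at depth `m`.  DEFINITION (the
node's new typed quantity). (Sources: Hironaka 1967 (characteristic polyhedra) §§1–3; CJS2020 Def. 7.? /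
Thm. 9.2 (the invariant δ); CossartPiltant2019 §2.) -/
def ArcCond (j : σ) (q m : ℕ) (G : MvPolynomial σ K) : Prop :=
  ∀ d ∈ G.support, IsPthPowerExponent q d ∨ m * (q - offDeg j d) ≤ d j

/-- `ArcCond.add`: Auxiliary step of this node's calculus, VERBATIM from the lens file (see the module docstring);
the statement is its type. [folklore] -/
theorem ArcCond.add {j : σ} {q m : ℕ} {G H : MvPolynomial σ K} (hG : ArcCond j q m G) (hH : ArcCond j q m H) :
    ArcCond j q m (G + H) := fun d hd => by
  rcases Finset.mem_union.mp (support_add hd) with h | h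
  · exact hG d h
  · exact hH d h

/-- `ArcCond.neg`: Auxiliary step of this node's calculus, VERBATIM from the lens file (see the module docstring);
the statement is its type. [folklore] -/
theorem ArcCond.neg {j : σ} {q m : ℕ} {G : MvPolynomial σ K} (hG : ArcCond j q m G) : ArcCond j q m (-G) :=
  fun d hd => hG d (by rwa [support_neg] at hd)

/-- `ArcCond.sub`: Auxiliary step of this node's calculus, VERBATIM from the lens file (see the module docstring);
the statement is its type. [folklore] -/
theorem ArcCond.sub {j : σ} {q m : ℕ} {G H : MvPolynomial σ K} (hG : ArcCond j q m G) (hH : ArcCond j q m H) :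
    ArcCond j q m (G - H) := by
  rw [sub_eq_add_neg]; exact hG.add hH.neg

/-- `IsQPow.arcCond`: Auxiliary step of this node's calculus, VERBATIM from the lens file (see the module
docstring); the statement is its type. [folklore] -/
theorem IsQPow.arcCond {j : σ} {q m : ℕ} {G : MvPolynomial σ K} (hG : IsQPow q G) : ArcCond j q m G :=
  fun d hd => Or.inl (hG d hd)

/-- `ArcCond.mono`: Auxiliary step of this node's calculus, VERBATIM from the lens file (see the module docstring);
the statement is its type. [folklore] -/
theorem ArcCond.mono {j : σ} {q m m' : ℕ} (hm : m' ≤ m) {G : MvPolynomial σ K} (hG : ArcCond j q m G) :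
    ArcCond j q m' G := fun d hd => (hG d hd).imp_right fun h => le_trans (Nat.mul_le_mul_right _ hm) h

omit [Fintype σ] in
/-- The polynomial minus its cleaning is a `q`-power polynomial. [folklore] -/
theorem isQPow_sub_deletePthPowers (q : ℕ) (G : MvPolynomial σ K) : IsQPow q (G - deletePthPowers q G) := by
  rw [isQPow_iff_coeff]
  intro d hd
  rw [coeff_sub, coeff_deletePthPowers] at hd
  by_cases h : IsPthPowerExponent q d
  · exact (isPthPowerExponent_iff q d).mp h
  · rw [if_neg h, sub_self] at hd; exact absurd rfl hd

/-- Cleaning does not change the arc condition. [folklore] -/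
theorem arcCond_deletePthPowers_iff (j : σ) (q m : ℕ) (G : MvPolynomial σ K) :
    ArcCond j q m (deletePthPowers q G) ↔ ArcCond j q m G := by
  constructor
  · intro h
    have := h.add (isQPow_sub_deletePthPowers q G).arcCond (j := j) (m := m)
    rwa [add_sub_cancel] at this
  · intro h
    have := h.sub (isQPow_sub_deletePthPowers q G).arcCond (j := j) (m := m)
    rwa [sub_sub_cancel] at this

omit [Fintype σ] in
/-- No monomial survives cleaning with a `q`-power exponent. [folklore] -/
theorem not_isPthPowerExponent_of_mem_support_deletePthPowers {q : ℕ} {G : MvPolynomial σ K} {d : σ →₀ ℕ}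
    (hd : d ∈ (deletePthPowers q G).support) : ¬ IsPthPowerExponent q d := by
  intro h
  rw [MvPolynomial.mem_support_iff, coeff_deletePthPowers, if_pos h] at hd
  exact hd rfl

omit [Fintype σ] in
/-- A cleaned `q`-power polynomial vanishes. [folklore] -/
theorem eq_zero_of_isQPow_of_clean {q : ℕ} {F : MvPolynomial σ K} (hF : deletePthPowers q F = F)
    (hQ : IsQPow q F) : F = 0 := by
  by_contra h
  obtain ⟨d, hd⟩ := Finset.nonempty_iff_ne_empty.mpr (fun he => h (support_eq_empty.mp he))
  exact CampaignW46.MohWindowShadeAnchorOrder.not_isPthPowerExponent_of_cleaned hF hd (hQ d hd)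

end Arc

/-! ## §3 Order bookkeeping: `OrdGE q F` (all monomials of degree `≥ q`) -/

section OrdGE

variable {σ : Type} [DecidableEq σ] [Fintype σ] {K : Type} [Field K]

/-- All monomials of `F` have degree `≥ q` (`q ≤ ord₀ F`). -/
def OrdGE (q : ℕ) (F : MvPolynomial σ K) : Prop := ∀ d ∈ F.support, q ≤ d.degree

omit [DecidableEq σ] [Fintype σ] in
/-- `ordGE_iff_ordZero`: Auxiliary step of this node's calculus, VERBATIM from the lens file (see the module
docstring); the statement is its type. [folklore] -/
theorem ordGE_iff_ordZero (q : ℕ) (F : MvPolynomial σ K) : OrdGE q F ↔ (q : ℕ∞) ≤ ordZero F := by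
  rw [natCast_le_ordZero_iff_forall_coeff]
  constructor
  · intro h d hd
    by_contra hc
    exact absurd (h d (MvPolynomial.mem_support_iff.mpr hc)) (not_le.mpr hd)
  · intro h d hd
    by_contra hc
    exact (MvPolynomial.mem_support_iff.mp hd) (h d (not_le.mp hc))

omit [DecidableEq σ] [Fintype σ] in
/-- `OrdGE.aeval`: Auxiliary step of this node's calculus, VERBATIM from the lens file (see the module docstring);
the statement is its type. [folklore] -/
theorem OrdGE.aeval {q : ℕ} {F : MvPolynomial σ K} (hF : OrdGE q F) (f : σ → MvPolynomial σ K)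
    (hf : ∀ i, constantCoeff (f i) = 0) : OrdGE q (MvPolynomial.aeval f F) := by
  rw [ordGE_iff_ordZero] at hF ⊢
  exact le_trans hF (le_ordZero_aeval f hf F)

omit [Fintype σ] in
/-- `OrdGE.add`: Auxiliary step of this node's calculus, VERBATIM from the lens file (see the module docstring); the
statement is its type. [folklore] -/
theorem OrdGE.add {q : ℕ} {F G : MvPolynomial σ K} (hF : OrdGE q F) (hG : OrdGE q G) : OrdGE q (F + G) :=
  fun d hd => by
    rcases Finset.mem_union.mp (support_add hd) with h | h
    · exact hF d h
    · exact hG d h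

omit [Fintype σ] in
/-- `OrdGE.deletePthPowers`: Auxiliary step of this node's calculus, VERBATIM from the lens file (see the module
docstring); the statement is its type. [folklore] -/
theorem OrdGE.deletePthPowers {q : ℕ} {F : MvPolynomial σ K} (hF : OrdGE q F) (q' : ℕ) :
    OrdGE q (deletePthPowers q' F) := fun d hd => by
  refine hF d (MvPolynomial.mem_support_iff.mpr fun h => MvPolynomial.mem_support_iff.mp hd ?_)
  rw [coeff_deletePthPowers, h, ite_self]

end OrdGE

end

end Summit.ResolutionOfSingularities.ResolutionOfSingularities.Theorems.FloorDescent
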